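import Summits.MatrixMultiplication.MatrixMultiplication.Theses.ThinBlockAlpha
import Summits.MatrixMultiplication.MatrixMultiplication.Theorems.ThinPackings.Negative.FrameDesignBoxCount

/-!
# Volume excess — the kill criterion for the Euclidean-frame lines (crux `ThinPackings`, stmt-MatrixMultiplication-10595)

Lead a1 (line `three-sphere-frame-designs`, 2026-08-16).  Both surviving lines of the crux chain end in a
DESIGN stub for orthogonal frames in a box `[-b, b]^D ⊂ ℤ^D` transported carry-free into `(ℤ/(6b+1))^D`:
`stub_frameDesign` (sphere line, constant radii) and `stub_generalFrameDesigns` (label-weighted line, per-block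
radii + order-compatible potentials).  This file makes lead c1's observation kernel-checked and sharpens it
into a single-block criterion:

* `volume_excess`: ANY witness of either design stub at a shape exponent `a` and slack `η` with `η < a` has
  total block volume `Σᵢ |Aᵢ||Bᵢ||Cᵢ| = L·N²·M > (6b+1)^D` — it is an STPP family certifying `ω < 3` through
  CKSU (1.1) in the carry-free host.  So the conjecture `FrameNoExcess` (`Σᵢ |Aᵢ||Bᵢ||Cᵢ| ≤ (6b+1)^D` for every
  box frame family with the three packings) REFUTES BOTH STUBS: `not_sphereFrameDesigns_of_frameNoExcess`,
  `not_generalFrameDesigns_of_frameNoExcess` (statements verbatim = the registered stubs).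
* `volume_le_of_price` (LP weak duality for the three packings): if nonnegative prices `p` on a tile set `Q`
  pay every block at least thrice its volume (`3·|A||B||C| ≤ p(C−A) + p(B−A) + p(B−C)`), then the total volume
  of a packed family is at most `Σ_{v ∈ Q} p v`; `three_mul_le_add_of_pow_le` is the AM–GM form of the block
  hypothesis (`V³ ≤ p(T)·p(E)·p(F)`), which is MULTIPLICATIVE under products of blocks, and
  `volume_le_pow_of_coordPrice` is the coordinatewise-product instance: a single-block inequality
  `(|A||B||C|)³ ≤ q(C−A)·q(B−A)·q(B−C)` for `q(v) = ∏ₜ w |vₜ|` valid for ALL orthogonal frame blocks in dimension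
  `D` bounds every packed family by `(Σ_{u=-2b}^{2b} w |u|)^D`; with `Σ w ≤ 6b+1` that is `FrameNoExcess` at `b`.
  (Numerics, lead a1 kit j018235: at `b = 1` such a `w` exists against all blocks of dimension ≤ 4 with budget
  ≈ 5.4 < 7; for `b ≥ 4` NO coordinatewise `w` can work — spread two-leg blocks — so a proof of `FrameNoExcess`
  for the large boxes the stubs need must price tiles non-locally.)

Elementary and sorry-free; hypotheses are the registered conjuncts verbatim (weak packings `→ i = k` for the
sphere line, strong packings for the label-weighted line; pointwise orthogonality makes them equivalent).
-/

set_option linter.dupNamespace false  -- `Summit.<S>.<S>.…` is the mandated namespace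

namespace Summit.MatrixMultiplication.MatrixMultiplication.Theorems.ThinPackings.Negative

open Finset

section VolumeExcess

variable {D L : ℕ}

/-- Blocks of one shape `⟨N, M, N⟩` have total volume `L·(N²·M)`. [folklore] -/
theorem sum_volume_eq_of_cards {α : Type*} {N M : ℕ} (A B C : Fin L → Finset α)
    (hc : ∀ i, (A i).card = N ∧ (B i).card = M ∧ (C i).card = N) :
    ∑ i, (A i).card * (B i).card * (C i).card = L * (N ^ 2 * M) := by
  rw [Finset.sum_congr rfl fun i _ => by rw [(hc i).1, (hc i).2.1, (hc i).2.2], sum_const, card_univ,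
    Fintype.card_fin, smul_eq_mul]
  ring

/-- **Volume excess.**  The count `(6b+1)^D ≤ L·N^{2+η}` of a design with `2 ≤ N`, `N^a ≤ M` and `η < a`
forces `(6b+1)^D < L·N²·M`: below the diagonal the total block volume exceeds the carry-free host.
[new, elementary] -/
theorem volume_excess {N M b : ℕ} {a η : ℝ} (hN : 2 ≤ N) (hM : (N : ℝ) ^ a ≤ M) (hηa : η < a)
    (hcount : (((6 * b + 1 : ℕ) : ℝ)) ^ D ≤ L * (N : ℝ) ^ (2 + η)) :
    (((6 * b + 1 : ℕ) : ℝ)) ^ D < L * ((N : ℝ) ^ 2 * M) := by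
  have hN1 : (1 : ℝ) < N := by exact_mod_cast (by omega : 1 < N)
  have hNpos : (0 : ℝ) < N := by linarith
  have hL : 1 ≤ L := by
    by_contra hL0
    have hL0 : L = 0 := by omega
    rw [hL0, Nat.cast_zero, zero_mul] at hcount
    have : (0 : ℝ) < (((6 * b + 1 : ℕ) : ℝ)) ^ D := by positivity
    linarith
  have hLpos : (0 : ℝ) < L := by exact_mod_cast (by omega : 0 < L)
  have hlt : (N : ℝ) ^ (2 + η) < (N : ℝ) ^ 2 * M := by
    rw [Real.rpow_add hNpos, Real.rpow_two]
    have hη : (N : ℝ) ^ η < (N : ℝ) ^ a := Real.rpow_lt_rpow_of_exponent_lt hN1 hηa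
    have hN2 : (0 : ℝ) < (N : ℝ) ^ 2 := by positivity
    calc (N : ℝ) ^ 2 * (N : ℝ) ^ η < (N : ℝ) ^ 2 * (N : ℝ) ^ a := mul_lt_mul_of_pos_left hη hN2
      _ ≤ (N : ℝ) ^ 2 * M := by gcongr
  calc (((6 * b + 1 : ℕ) : ℝ)) ^ D ≤ L * (N : ℝ) ^ (2 + η) := hcount
    _ < L * ((N : ℝ) ^ 2 * M) := mul_lt_mul_of_pos_left hlt hLpos

/-- The same in `ℕ`, on the family: `(6b+1)^D < Σᵢ |Aᵢ||Bᵢ||Cᵢ|`. [new, elementary] -/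
theorem volume_excess_family {α : Type*} {N M b : ℕ} {a η : ℝ} (A B C : Fin L → Finset α)
    (hc : ∀ i, (A i).card = N ∧ (B i).card = M ∧ (C i).card = N) (hN : 2 ≤ N) (hM : (N : ℝ) ^ a ≤ M)
    (hηa : η < a) (hcount : (((6 * b + 1 : ℕ) : ℝ)) ^ D ≤ L * (N : ℝ) ^ (2 + η)) :
    (6 * b + 1) ^ D < ∑ i, (A i).card * (B i).card * (C i).card := by
  rw [sum_volume_eq_of_cards A B C hc]
  have h := volume_excess (D := D) (L := L) hN hM hηa hcount
  have h' : (((6 * b + 1) ^ D : ℕ) : ℝ) < ((L * (N ^ 2 * M) : ℕ) : ℝ) := by push_cast at h ⊢; exact h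
  exact_mod_cast h'

/-- **FrameNoExcess** (conjecture, lead c1 2026-08-16; the kill criterion for both frame lines): for every
orthogonal frame family in the box `[-b, b]^D` — pointwise orthogonal legs inside each block and the three weak
packings (a tile `z − x`, `y − x`, `y − z` determines its block) — the total block volume is at most the size
`(6b+1)^D` of the carry-free host.  Equivalently: no carry-free frame family certifies `ω < 3` via CKSU (1.1).
Known: coordinate (USP-type) families reach `(2b)^D·|U| ≤ (6b)^D`; exhaustive optima `3b`, `12b²`, `≈ 56`
(b = 1, D = 3) (lead c1); a coordinatewise price certificate exists numerically at `b = 1` for all blocks of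
dimension `≤ 4` and provably cannot exist for `b ≥ 4` (lead a1). [conjecture — NOT proved here] -/
def FrameNoExcess : Prop :=
  ∀ (D L b : ℕ) (A B C : Fin L → Finset (Fin D → ℤ)),
    (∀ i, (∀ v ∈ A i, ∀ t, |v t| ≤ (b : ℤ)) ∧ (∀ v ∈ B i, ∀ t, |v t| ≤ (b : ℤ)) ∧
      (∀ v ∈ C i, ∀ t, |v t| ≤ (b : ℤ))) →
    ((∀ i, ∀ x ∈ A i, ∀ y ∈ B i, x ⬝ᵥ y = 0) ∧ (∀ i, ∀ x ∈ A i, ∀ z ∈ C i, x ⬝ᵥ z = 0) ∧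
      (∀ i, ∀ y ∈ B i, ∀ z ∈ C i, y ⬝ᵥ z = 0)) →
    (∀ i k, ∀ x ∈ A i, ∀ z ∈ C i, ∀ x' ∈ A k, ∀ z' ∈ C k, z - x = z' - x' → i = k) →
    (∀ i k, ∀ x ∈ A i, ∀ y ∈ B i, ∀ x' ∈ A k, ∀ y' ∈ B k, y - x = y' - x' → i = k) →
    (∀ i k, ∀ y ∈ B i, ∀ z ∈ C i, ∀ y' ∈ B k, ∀ z' ∈ C k, y - z = y' - z' → i = k) →
    ∑ i, (A i).card * (B i).card * (C i).card ≤ (6 * b + 1) ^ D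

/-- The registered design stub of line `three-sphere-frame-designs` (`stub_frameDesign`, verbatim): constant-radius
orthogonal sphere frames in a box with the three packings, the all-distinct clause, blocks `⟨N, M, N⟩`, `N ≥ 2`,
`N^a ≤ M`, and the carry-free two-leg count `(6R+1)^D ≤ L·N^{2+η}`, for EVERY `a < 1`, `η > 0`.
[the line's heart; ≥ X_C-hard; restated here only to be negated] -/
def SphereFrameDesigns : Prop :=
  ∀ a : ℝ, 0 ≤ a → a < 1 → ∀ η : ℝ, 0 < η →
    ∃ (D R L N M : ℕ) (rA rB rC : ℤ) (A B C : Fin L → Finset (Fin D → ℤ)),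
      (∀ i, ∀ x ∈ A i, ∀ t, |x t| ≤ (R : ℤ)) ∧ (∀ i, ∀ y ∈ B i, ∀ t, |y t| ≤ (R : ℤ)) ∧
      (∀ i, ∀ z ∈ C i, ∀ t, |z t| ≤ (R : ℤ)) ∧
      (∀ i, ∀ x ∈ A i, x ⬝ᵥ x = rA) ∧ (∀ i, ∀ y ∈ B i, y ⬝ᵥ y = rB) ∧
      (∀ i, ∀ z ∈ C i, z ⬝ᵥ z = rC) ∧
      (∀ i, ∀ x ∈ A i, ∀ y ∈ B i, x ⬝ᵥ y = 0) ∧ (∀ i, ∀ x ∈ A i, ∀ z ∈ C i, x ⬝ᵥ z = 0) ∧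
      (∀ i, ∀ y ∈ B i, ∀ z ∈ C i, y ⬝ᵥ z = 0) ∧
      (∀ i k, ∀ x ∈ A i, ∀ z ∈ C i, ∀ x' ∈ A k, ∀ z' ∈ C k, z - x = z' - x' → i = k) ∧
      (∀ i k, ∀ x ∈ A i, ∀ y ∈ B i, ∀ x' ∈ A k, ∀ y' ∈ B k, y - x = y' - x' → i = k) ∧
      (∀ i k, ∀ y ∈ B i, ∀ z ∈ C i, ∀ y' ∈ B k, ∀ z' ∈ C k, y - z = y' - z' → i = k) ∧
      (∀ i j k : Fin L, i ≠ j → j ≠ k → i ≠ k →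
        ∀ s ∈ A k, ∀ s' ∈ A i, ∀ t ∈ B i, ∀ t' ∈ B j, ∀ u ∈ C j, ∀ u' ∈ C k,
          (s' - s) + (t' - t) + (u' - u) ≠ 0) ∧
      (∀ i, (A i).card = N ∧ (B i).card = M ∧ (C i).card = N) ∧ 2 ≤ N ∧
      (N : ℝ) ^ a ≤ M ∧ (((6 * R + 1) ^ D : ℕ) : ℝ) ≤ L * (N : ℝ) ^ (2 + η)

/-- **Kill reduction, sphere line.**  `FrameNoExcess` refutes the design stub `stub_frameDesign`: instantiate it
at `(a, η) = (1/2, 1/4)` and compare `volume_excess_family` with the conjectured bound. [new, elementary] -/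
theorem not_sphereFrameDesigns_of_frameNoExcess (hNE : FrameNoExcess) : ¬ SphereFrameDesigns := by
  intro h
  obtain ⟨D, R, L, N, M, rA, rB, rC, A, B, C, hbA, hbB, hbC, -, -, -, hoAB, hoAC, hoBC, hPD, hPE, hPF, -,
    hcard, hN, hM, hH⟩ := h (1 / 2) (by norm_num) (by norm_num) (1 / 4) (by norm_num)
  have hle := hNE D L R A B C (fun i => ⟨hbA i, hbB i, hbC i⟩) ⟨hoAB, hoAC, hoBC⟩ hPD hPE hPF
  have hH' : (((6 * R + 1 : ℕ) : ℝ)) ^ D ≤ L * (N : ℝ) ^ (2 + (1 / 4 : ℝ)) := by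
    have : ((((6 * R + 1) ^ D : ℕ)) : ℝ) = (((6 * R + 1 : ℕ) : ℝ)) ^ D := by push_cast; ring
    rw [← this]; exact hH
  have hlt := volume_excess_family A B C hcard hN hM (by norm_num : (1 / 4 : ℝ) < 1 / 2) hH'
  omega

/-- **Kill reduction, label-weighted line.**  `FrameNoExcess` also refutes `stub_generalFrameDesigns`
(verbatim; per-block radii, order-compatible potentials, strong packings — only the frame, box, packing,
cardinality and count conjuncts are used). [new, elementary] -/
theorem not_generalFrameDesigns_of_frameNoExcess (hNE : FrameNoExcess) :
    ¬ (∀ a : ℝ, 0 ≤ a → a < 1 → ∀ η : ℝ, 0 < η →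
      ∃ (D L N M b R : ℕ) (A B C : Fin L → Finset (Fin D → ℤ)) (rA rB rC κ μ : Fin L → ℤ),
        ((∀ i, ∀ x ∈ A i, ∀ y ∈ B i, x ⬝ᵥ y = 0) ∧ (∀ i, ∀ x ∈ A i, ∀ z ∈ C i, x ⬝ᵥ z = 0) ∧
          (∀ i, ∀ y ∈ B i, ∀ z ∈ C i, y ⬝ᵥ z = 0)) ∧
        ((∀ i, ∀ x ∈ A i, x ⬝ᵥ x = rA i) ∧ (∀ i, ∀ y ∈ B i, y ⬝ᵥ y = rB i) ∧
          (∀ i, ∀ z ∈ C i, z ⬝ᵥ z = rC i)) ∧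
        ((∀ i k, rA k + rB k < rA i + rB i → κ k + 1 ≤ κ i) ∧
          (∀ i k, rB k + rC k < rB i + rC i → μ k + 1 ≤ μ i) ∧
          (∀ i k, rA i + rC i < rA k + rC k → κ k + μ k + 1 ≤ κ i + μ i)) ∧
        ((∀ i k, ∀ a ∈ A i, ∀ c ∈ C i, ∀ a' ∈ A k, ∀ c' ∈ C k, c - a = c' - a' → i = k ∧ a = a' ∧ c = c') ∧
         (∀ i k, ∀ a ∈ A i, ∀ b ∈ B i, ∀ a' ∈ A k, ∀ b' ∈ B k, b - a = b' - a' → i = k ∧ a = a' ∧ b = b') ∧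
         (∀ i k, ∀ b ∈ B i, ∀ c ∈ C i, ∀ b' ∈ B k, ∀ c' ∈ C k, b - c = b' - c' → i = k ∧ b = b' ∧ c = c') ∧
         (∀ i j k : Fin L, i ≠ j → j ≠ k → i ≠ k → (κ i - κ k) + (μ j - μ k) ≤ 0 →
            ∀ s ∈ A k, ∀ s' ∈ A i, ∀ t ∈ B i, ∀ t' ∈ B j, ∀ u ∈ C j, ∀ u' ∈ C k,
              (s' - s) + (t' - t) + (u' - u) ≠ 0)) ∧
        (∀ i, (A i).card = N ∧ (B i).card = M ∧ (C i).card = N) ∧ 2 ≤ N ∧ (N : ℝ) ^ a ≤ M ∧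
        (∀ i, (∀ v ∈ A i, ∀ t, |v t| ≤ (b : ℤ)) ∧ (∀ v ∈ B i, ∀ t, |v t| ≤ (b : ℤ)) ∧
          (∀ v ∈ C i, ∀ t, |v t| ≤ (b : ℤ))) ∧
        (∀ i, |κ i| ≤ (R : ℤ) ∧ |μ i| ≤ (R : ℤ)) ∧
        (((6 * b + 1 : ℕ) : ℝ)) ^ D ≤ L * (N : ℝ) ^ (2 + η)) := by
  intro h
  obtain ⟨D, L, N, M, b, R, A, B, C, rA, rB, rC, κ, μ, hfr, -, -, ⟨hR1, hR2, hR3, -⟩, hcard, hN, hM, hbox,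
    -, hcount⟩ := h (1 / 2) (by norm_num) (by norm_num) (1 / 4) (by norm_num)
  have hle := hNE D L b A B C hbox hfr
    (fun i k x hx z hz x' hx' z' hz' he => (hR1 i k x hx z hz x' hx' z' hz' he).1)
    (fun i k x hx y hy x' hx' y' hy' he => (hR2 i k x hx y hy x' hx' y' hy' he).1)
    (fun i k y hy z hz y' hy' z' hz' he => (hR3 i k y hy z hz y' hy' z' hz' he).1)
  have hlt := volume_excess_family A B C hcard hN hM (by norm_num : (1 / 4 : ℝ) < 1 / 2) hcount
  omega

end VolumeExcess

/-! ## Pricing (LP weak duality) for the three packings -/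

section Pricing

variable {α : Type*} [DecidableEq α] [AddCommGroup α] {L : ℕ}

/-- A packed difference family injects into its tile set, so its priced size is at most the total price.
[folklore] -/
theorem sum_sum_price_le (X Z : Fin L → Finset α) (Q : Finset α) (p : α → ℝ) (hp : ∀ v ∈ Q, 0 ≤ p v)
    (hQ : ∀ i, ∀ x ∈ X i, ∀ z ∈ Z i, z - x ∈ Q)
    (hpack : ∀ i k, ∀ x ∈ X i, ∀ z ∈ Z i, ∀ x' ∈ X k, ∀ z' ∈ Z k, z - x = z' - x' → i = k ∧ x = x' ∧ z = z') :
    ∑ i, ∑ x ∈ X i, ∑ z ∈ Z i, p (z - x) ≤ ∑ v ∈ Q, p v := by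
  classical
  set S : Finset (Σ _ : Fin L, α × α) := univ.sigma fun i => X i ×ˢ Z i with hS
  set f : (Σ _ : Fin L, α × α) → α := fun s => s.2.2 - s.2.1 with hf
  have hinj : Set.InjOn f ↑S := by
    rintro ⟨i, x, z⟩ hx ⟨k, x', z'⟩ hy he
    simp only [hS, coe_sigma, Set.mem_sigma_iff, coe_univ, Set.mem_univ, true_and, coe_product,
      Set.mem_prod, mem_coe] at hx hy
    change z - x = z' - x' at he
    obtain ⟨rfl, rfl, rfl⟩ := hpack i k x hx.1 z hx.2 x' hy.1 z' hy.2 he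
    rfl
  have himg : S.image f ⊆ Q := by
    intro v hv
    rw [mem_image] at hv
    obtain ⟨⟨i, x, z⟩, hx, rfl⟩ := hv
    simp only [hS, mem_sigma, mem_univ, true_and, mem_product] at hx
    exact hQ i x hx.1 z hx.2
  have h1 : ∑ i, ∑ x ∈ X i, ∑ z ∈ Z i, p (z - x) = ∑ s ∈ S, p (f s) := by
    rw [hS, sum_sigma]
    refine Finset.sum_congr rfl fun i _ => ?_
    rw [sum_product]
  rw [h1, ← sum_image hinj]
  exact sum_le_sum_of_subset_of_nonneg himg fun v hv _ => hp v hv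

/-- **LP weak duality for the three packings.**  If nonnegative prices on a tile set `Q` containing all tiles
pay every block at least `3·|Aᵢ||Bᵢ||Cᵢ|`, then the total volume of a family with the three (strong) packings
is at most the total price `Σ_{v∈Q} p v`. [new, elementary] -/
theorem volume_le_of_price (A B C : Fin L → Finset α) (Q : Finset α) (p : α → ℝ) (hp : ∀ v ∈ Q, 0 ≤ p v)
    (hQT : ∀ i, ∀ x ∈ A i, ∀ z ∈ C i, z - x ∈ Q) (hQE : ∀ i, ∀ x ∈ A i, ∀ y ∈ B i, y - x ∈ Q)
    (hQF : ∀ i, ∀ z ∈ C i, ∀ y ∈ B i, y - z ∈ Q)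
    (hPT : ∀ i k, ∀ x ∈ A i, ∀ z ∈ C i, ∀ x' ∈ A k, ∀ z' ∈ C k, z - x = z' - x' → i = k ∧ x = x' ∧ z = z')
    (hPE : ∀ i k, ∀ x ∈ A i, ∀ y ∈ B i, ∀ x' ∈ A k, ∀ y' ∈ B k, y - x = y' - x' → i = k ∧ x = x' ∧ y = y')
    (hPF : ∀ i k, ∀ z ∈ C i, ∀ y ∈ B i, ∀ z' ∈ C k, ∀ y' ∈ B k, y - z = y' - z' → i = k ∧ z = z' ∧ y = y')
    (hblock : ∀ i, 3 * (((A i).card * (B i).card * (C i).card : ℕ) : ℝ) ≤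
      (∑ x ∈ A i, ∑ z ∈ C i, p (z - x)) + (∑ x ∈ A i, ∑ y ∈ B i, p (y - x)) +
        ∑ z ∈ C i, ∑ y ∈ B i, p (y - z)) :
    ∑ i, (((A i).card * (B i).card * (C i).card : ℕ) : ℝ) ≤ ∑ v ∈ Q, p v := by
  have hT := sum_sum_price_le A C Q p hp hQT hPT
  have hE := sum_sum_price_le A B Q p hp hQE hPE
  have hF := sum_sum_price_le C B Q p hp hQF hPF
  have h3 : 3 * ∑ i, (((A i).card * (B i).card * (C i).card : ℕ) : ℝ) ≤ 3 * ∑ v ∈ Q, p v := by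
    rw [mul_sum]
    calc ∑ i, 3 * (((A i).card * (B i).card * (C i).card : ℕ) : ℝ)
        ≤ ∑ i, ((∑ x ∈ A i, ∑ z ∈ C i, p (z - x)) + (∑ x ∈ A i, ∑ y ∈ B i, p (y - x)) +
            ∑ z ∈ C i, ∑ y ∈ B i, p (y - z)) := sum_le_sum fun i _ => hblock i
      _ = (∑ i, ∑ x ∈ A i, ∑ z ∈ C i, p (z - x)) + (∑ i, ∑ x ∈ A i, ∑ y ∈ B i, p (y - x)) +
            ∑ i, ∑ z ∈ C i, ∑ y ∈ B i, p (y - z) := by rw [sum_add_distrib, sum_add_distrib]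
      _ ≤ (∑ v ∈ Q, p v) + (∑ v ∈ Q, p v) + ∑ v ∈ Q, p v := by gcongr
      _ = 3 * ∑ v ∈ Q, p v := by ring
  linarith

/-- AM–GM form of the block hypothesis: `V³ ≤ t·e·f` with `t, e, f ≥ 0` gives `3V ≤ t + e + f`.  The cubic form
is the one that MULTIPLIES under products of blocks (tensor-stable certificate). [folklore] -/
theorem three_mul_le_add_of_pow_le {V t e f : ℝ} (hV : 0 ≤ V) (ht : 0 ≤ t) (he : 0 ≤ e) (hf : 0 ≤ f)
    (h : V ^ 3 ≤ t * e * f) : 3 * V ≤ t + e + f := by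
  have hw : (0 : ℝ) ≤ 1 / 3 := by norm_num
  have hgm := Real.geom_mean_le_arith_mean3_weighted hw hw hw ht he hf (by norm_num)
  have hV3 : V ≤ t ^ (1 / 3 : ℝ) * e ^ (1 / 3 : ℝ) * f ^ (1 / 3 : ℝ) := by
    rw [← Real.mul_rpow ht he, ← Real.mul_rpow (mul_nonneg ht he) hf]
    calc V = (V ^ (3 : ℕ)) ^ (1 / 3 : ℝ) := by
          rw [← Real.rpow_natCast, ← Real.rpow_mul hV]; norm_num
      _ ≤ (t * e * f) ^ (1 / 3 : ℝ) := Real.rpow_le_rpow (by positivity) h (by norm_num)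
  linarith

end Pricing

/-! ## Coordinatewise product prices on the box `ℤ^D` -/

section CoordPrice

variable {D L : ℕ}

/-- The coordinatewise product price `q(v) = ∏ₜ w |vₜ|`. -/
def coordPrice (w : ℕ → ℝ) (v : Fin D → ℤ) : ℝ := ∏ t, w (v t).natAbs

/-- The total coordinatewise price of the doubled box `[-2b, 2b]^D` is `(Σ_{u=-2b}^{2b} w |u|)^D`. [folklore] -/
theorem sum_coordPrice_box (w : ℕ → ℝ) (b : ℕ) :
    ∑ v ∈ Fintype.piFinset (fun _ : Fin D => Icc (-(2 * b : ℤ)) (2 * b)), coordPrice w v =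
      (∑ u ∈ Icc (-(2 * b : ℤ)) (2 * b), w u.natAbs) ^ D := by
  unfold coordPrice
  rw [← Finset.prod_univ_sum (fun _ : Fin D => Icc (-(2 * b : ℤ)) (2 * b)) fun _ u => w u.natAbs,
    prod_const, card_univ, Fintype.card_fin]

/-- Pointwise orthogonality of two legs makes the difference map injective inside a block, so the WEAK packing
`z − x = z' − x' → i = k` upgrades to the strong one. [folklore; cf. `PairCollapse.endpoints_eq`] -/
theorem strong_packing_of_weak (X Z : Fin L → Finset (Fin D → ℤ))
    (horth : ∀ i, ∀ x ∈ X i, ∀ z ∈ Z i, x ⬝ᵥ z = 0)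
    (hweak : ∀ i k, ∀ x ∈ X i, ∀ z ∈ Z i, ∀ x' ∈ X k, ∀ z' ∈ Z k, z - x = z' - x' → i = k) :
    ∀ i k, ∀ x ∈ X i, ∀ z ∈ Z i, ∀ x' ∈ X k, ∀ z' ∈ Z k, z - x = z' - x' → i = k ∧ x = x' ∧ z = z' := by
  intro i k x hx z hz x' hx' z' hz' he
  obtain rfl := hweak i k x hx z hz x' hx' z' hz' he
  -- inside block `i`: `z - z' = x - x'` is orthogonal to itself
  have hv : z - z' = x - x' := by
    have := he; rw [sub_eq_sub_iff_add_eq_add] at this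
    rw [sub_eq_sub_iff_add_eq_add]; linear_combination this
  have hself : (z - z') ⬝ᵥ (z - z') = 0 := by
    have h0 : (x - x') ⬝ᵥ (z - z') = 0 := by
      rw [sub_dotProduct, dotProduct_sub, dotProduct_sub, horth i x hx z hz, horth i x hx z' hz',
        horth i x' hx' z hz, horth i x' hx' z' hz']
      ring
    calc (z - z') ⬝ᵥ (z - z') = (x - x') ⬝ᵥ (z - z') := by rw [← hv]
      _ = 0 := h0
  have hz0 : z - z' = 0 := dotProduct_self_eq_zero.1 hself
  have hx0 : x - x' = 0 := by rw [← hv, hz0]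
  exact ⟨rfl, (sub_eq_zero.1 hx0), (sub_eq_zero.1 hz0)⟩

/-- **The tensor-stable certificate.**  If a nonnegative coordinatewise price `w` satisfies the single-block
inequality `(|A||B||C|)³ ≤ q(C−A)·q(B−A)·q(B−C)` for EVERY block of an orthogonal frame family in the box
`[-b, b]^D` with the three weak packings, then the family's total volume is at most `(Σ_{u=-2b}^{2b} w |u|)^D`.
In particular a `w` valid for all frame blocks with `Σ_{u=-2b}^{2b} w|u| ≤ 6b+1` proves `FrameNoExcess` at `b`.
[new, elementary] -/
theorem volume_le_pow_of_coordPrice (w : ℕ → ℝ) (hw : ∀ u, 0 ≤ w u) (b : ℕ)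
    (A B C : Fin L → Finset (Fin D → ℤ))
    (hbox : ∀ i, (∀ v ∈ A i, ∀ t, |v t| ≤ (b : ℤ)) ∧ (∀ v ∈ B i, ∀ t, |v t| ≤ (b : ℤ)) ∧
      (∀ v ∈ C i, ∀ t, |v t| ≤ (b : ℤ)))
    (hfr : (∀ i, ∀ x ∈ A i, ∀ y ∈ B i, x ⬝ᵥ y = 0) ∧ (∀ i, ∀ x ∈ A i, ∀ z ∈ C i, x ⬝ᵥ z = 0) ∧
      (∀ i, ∀ y ∈ B i, ∀ z ∈ C i, y ⬝ᵥ z = 0))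
    (hPD : ∀ i k, ∀ x ∈ A i, ∀ z ∈ C i, ∀ x' ∈ A k, ∀ z' ∈ C k, z - x = z' - x' → i = k)
    (hPE : ∀ i k, ∀ x ∈ A i, ∀ y ∈ B i, ∀ x' ∈ A k, ∀ y' ∈ B k, y - x = y' - x' → i = k)
    (hPF : ∀ i k, ∀ y ∈ B i, ∀ z ∈ C i, ∀ y' ∈ B k, ∀ z' ∈ C k, y - z = y' - z' → i = k)
    (hgeo : ∀ i, (((A i).card * (B i).card * (C i).card : ℕ) : ℝ) ^ 3 ≤
      (∑ x ∈ A i, ∑ z ∈ C i, coordPrice w (z - x)) * (∑ x ∈ A i, ∑ y ∈ B i, coordPrice w (y - x)) *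
        ∑ z ∈ C i, ∑ y ∈ B i, coordPrice w (y - z)) :
    ∑ i, (((A i).card * (B i).card * (C i).card : ℕ) : ℝ) ≤
      (∑ u ∈ Icc (-(2 * b : ℤ)) (2 * b), w u.natAbs) ^ D := by
  classical
  have hpnn : ∀ v : Fin D → ℤ, 0 ≤ coordPrice w v := fun v => prod_nonneg fun t _ => hw _
  obtain ⟨hoAB, hoAC, hoBC⟩ := hfr
  have hST := strong_packing_of_weak A C hoAC hPD
  have hSE := strong_packing_of_weak A B hoAB hPE
  have hSF : ∀ i k, ∀ z ∈ C i, ∀ y ∈ B i, ∀ z' ∈ C k, ∀ y' ∈ B k,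
      y - z = y' - z' → i = k ∧ z = z' ∧ y = y' := by
    refine strong_packing_of_weak C B (fun i z hz y hy => ?_) fun i k z hz y hy z' hz' y' hy' he =>
      hPF i k y hy z hz y' hy' z' hz' he
    rw [dotProduct_comm]; exact hoBC i y hy z hz
  have key := volume_le_of_price A B C (Fintype.piFinset fun _ : Fin D => Icc (-(2 * b : ℤ)) (2 * b))
    (coordPrice w) (fun v _ => hpnn v)
    (fun i x hx z hz => sub_mem_piFinset_Icc ((hbox i).1 x hx) ((hbox i).2.2 z hz))
    (fun i x hx y hy => sub_mem_piFinset_Icc ((hbox i).1 x hx) ((hbox i).2.1 y hy))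
    (fun i z hz y hy => sub_mem_piFinset_Icc ((hbox i).2.2 z hz) ((hbox i).2.1 y hy)) hST hSE hSF
    (fun i => three_mul_le_add_of_pow_le (Nat.cast_nonneg _)
      (sum_nonneg fun _ _ => sum_nonneg fun _ _ => hpnn _)
      (sum_nonneg fun _ _ => sum_nonneg fun _ _ => hpnn _)
      (sum_nonneg fun _ _ => sum_nonneg fun _ _ => hpnn _) (hgeo i))
  rw [sum_coordPrice_box] at key
  exact key

end CoordPrice

end Summit.MatrixMultiplication.MatrixMultiplication.Theorems.ThinPackings.Negative
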